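import Summits.FinalStateConjecture.FinalStateConjecture.Theorems.LogTimeThreeAnnuliSubconvergentEraGenericStubOrientationGaugeAbsorption
import HarnessLib

/-!
# Crux `LogTimeThreeAnnuli.SubconvergentEraGeneric` (stmt-FinalStateConjecture-17490) from the single
# remaining registered stub K = `stub_censoredOmegaLimitGeneric` of its birth skeleton (line `registered`)

The reduction half of the birth skeleton `Cruxes/SubconvergentEraGeneric/Lines/birth.lean`, landed as a
`--supports` piece so that "the crux is closed modulo K" is a tree theorem and not only a Cruxes workfile:

* `subconvergentEraGeneric_of_censoredOmegaLimitGeneric : K → SubconvergentEraGeneric` (both statements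
  INLINED — K is the registered stub signature verbatim, the conclusion is the body of the route decl
  `Summit.FinalStateConjecture.FinalStateConjecture.Theses.LogTimeThreeAnnuli.SubconvergentEraGeneric` with the
  window background written as the anonymous constructor `⟨domain, boostedKerrBilin …, time, radius⟩` instead
  of the update notation `{d.background i with bilin := …}` (the same term definitionally; the registrar cuts
  signatures at `:=`) — so that this module does not import the Theses file and can be imported by an
  eventual closing file, which obtains the route decl from it by `exact`).

K is the crux with ONE clause re-gauged: the hole charts' chart-time orientation is asserted in the sibling
producers' member-dependent VECTOR form (with each `ε`-close window member `(M, a)`, the push-forward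
`dΨᵢ (Λᵢ V_{M,a}(Λᵢ⁻¹(x − cᵢ)))` of that member's Kerr–Schild field `V = Kerr.timeVector M a` is `g`-future-directed
on `{t*ᵢ = τ, rᵢ ≤ ρ}`) instead of the crux's `(M,a)`-uniform COVECTOR form (`(Λᵢ⁻¹ w)⁰ > 0` for every
`g`-future-directed push-forward `dΨᵢ w`).  The proof is the monotonicity of tame Christodoulou genericity
(`InitialDataSet.IsTameChristodoulouGeneric`) in the property: pointwise on the admissible class the K-era gives
the crux-era by the landed adapter `stub_orientationGaugeAbsorption` (p145622, imported), so a datum exceptional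
for the crux's property is exceptional for K's, and K's tame immersed injective admissible curve through it
serves verbatim.  No analysis; K itself (tame-generic complete `𝓘⁺` ∧ all-`k` windowed boosted subconvergent
era ⊇ tame-generic weak cosmic censorship) stays OPEN — this file credits nothing towards it.

Sources: Christodoulou, CQG 16 (1999) A23, p. A24 (genericity by positive codimension; monotone in the
property); Dafermos–Luk arXiv:1710.01722, §1.2.1 (the conjecture the crux imports).
-/

noncomputable section

-- the doubled `FinalStateConjecture` path component is the summit/problem naming scheme
set_option linter.dupNamespace false

namespace Summit.FinalStateConjecture.FinalStateConjecture.Theorems.LogTimeThreeAnnuli.SubconvergentEraGeneric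

open Set Filter Function Topology
open scoped Manifold ContDiff ENNReal
open Literature.Geometry.Lorentzian

/-- **The crux from K.**  If the property "every MGHD has complete `𝓘⁺` and carries an honest subconvergent
final era with VECTOR-form (member-dependent `Kerr.timeVector`) chart-time orientation" is tame
Christodoulou-generic of codimension `≥ 1` in `admissibleVacuumData X` for every connected Hausdorff
second-countable smooth `3`-manifold `X` (the registered stub `stub_censoredOmegaLimitGeneric`, hypothesis
`hK`, stated verbatim), then so is the crux's property (covector-form orientation, all other clauses
identical): the statement of `Theses.LogTimeThreeAnnuli.SubconvergentEraGeneric`, verbatim.  Monotonicity of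
`IsTameChristodoulouGeneric` in the property through the pointwise adapter
`stub_orientationGaugeAbsorption`.  Christodoulou, CQG 16 (1999) A23, p. A24.
[cite: Christodoulou1999, p. A24] -/
theorem subconvergentEraGeneric_of_censoredOmegaLimitGeneric : (∀ (X : Type) [TopologicalSpace X] [ChartedSpace E3 X] [IsManifold (𝓡 3) ((⊤ : ℕ∞) : WithTop ℕ∞) X] [T2Space X] [SecondCountableTopology X] [ConnectedSpace X], InitialDataSet.IsTameChristodoulouGeneric (admissibleVacuumData X) (fun D => ∀ 𝒟 : VacuumCauchyDevelopment D, 𝒟.IsMaximal → Summit.FinalStateConjecture.HasCompleteNullInfinity 𝒟.toCauchyDevelopment ∧ (∃ (m₀ χ : ℝ) (O : Set 𝒟.carrier) (d : QuasiFinalStateDecomposition 𝒟.toSpacetime O 2 ⊤) (R : Fin d.N → ℝ → ℝ), 0 < m₀ ∧ χ < 1 ∧ O = Summit.FinalStateConjecture.exteriorOf 𝒟.toCauchyDevelopment d.charted ∧ Summit.FinalStateConjecture.RaysStayInClosure 𝒟.toCauchyDevelopment O ∧ (∀ i : Fin d.N, Filter.Tendsto (R i) Filter.atTop Filter.atTop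 ∧ ∀ τ : ℝ, max (Kerr.rPlus (d.mass i) (d.spin i)) 0 + 1 ≤ R i τ) ∧ (∀ τ₁ : ℝ, d.τ₀ < τ₁ → O \ d.certifiedLate R τ₁ ⊆ 𝒟.metric.causalPast 𝒟.timeOrientation (d.certifiedSlab R τ₁)) ∧ (∀ i : Fin d.N, Summit.FinalStateConjecture.IsOrthochronous (d.motion i).1) ∧ (∀ᶠ τ in Filter.atTop, ∀ x ∈ (Minkowski.backgroundOn d.flatDomain).timeSlab τ, 𝒟.timeOrientation.IsFutureDirected (mfderiv 𝓘(ℝ, E4) (𝓡 4) d.flatChart x (E4.basisVector 0))) ∧ (∀ k : ℕ, Filter.Tendsto (fun τ => 𝒟.toSpacetime.deviationCk (Minkowski.backgroundOn d.flatDomain) d.flatChart k τ) Filter.atTop (nhds 0)) ∧ (∀ (i : Fin d.N) (k : ℕ) (ρ : ℝ) (ε : ENNReal), 0 < ε → ∀ᶠ τ in Filter.atTop, ∃ M a : ℝ, m₀ ≤ M ∧ M ≤ m₀⁻¹ ∧ |a| ≤ χ * M ∧ 𝒟.toSpacetime.truncDeviationCk ⟨(d.background i).domain, boostedKerrBilin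 (d.motion i).1 (d.motion i).2 M a, (d.background i).time, (d.background i).radius⟩ (d.chart i) k ρ τ ≤ ε ∧ 𝒟.toSpacetime.truncDeviationCk ⟨(d.background i).domain, boostedKerrBilin (d.motion i).1 (d.motion i).2 M a, (d.background i).time, (d.background i).radius⟩ (d.chart i) k (R i τ) τ ≤ ε ∧ ∀ x ∈ (d.background i).truncTimeSlab ρ τ, 𝒟.timeOrientation.IsFutureDirected (mfderiv 𝓘(ℝ, E4) (𝓡 4) (d.chart i) x (((d.motion i).1 : E4 ≃L[ℝ] E4) (Kerr.timeVector M a (poincareInv (d.motion i).1 (d.motion i).2 (x : E4)))))))) 1) → ∀ (X : Type) [TopologicalSpace X] [ChartedSpace E3 X] [IsManifold (𝓡 3) ((⊤ : ℕ∞) : WithTop ℕ∞) X] [T2Space X] [SecondCountableTopology X] [ConnectedSpace X], InitialDataSet.IsTameChristodoulouGeneric (admissibleVacuumData X) (fun D => ∀ 𝒟 : VacuumCauchyDevelopment D, 𝒟.IsMaximal → Summit.FinalStateConjecture.HasCompleteNullInfinity 𝒟.toCauchyDevelopment ∧ (∃ (m₀ χ : ℝ) (O : Set 𝒟.carrier)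 (d : QuasiFinalStateDecomposition 𝒟.toSpacetime O 2 ⊤) (R : Fin d.N → ℝ → ℝ), 0 < m₀ ∧ χ < 1 ∧ O = Summit.FinalStateConjecture.exteriorOf 𝒟.toCauchyDevelopment d.charted ∧ Summit.FinalStateConjecture.RaysStayInClosure 𝒟.toCauchyDevelopment O ∧ (∀ i : Fin d.N, Filter.Tendsto (R i) Filter.atTop Filter.atTop ∧ ∀ τ : ℝ, max (Kerr.rPlus (d.mass i) (d.spin i)) 0 + 1 ≤ R i τ) ∧ (∀ τ₁ : ℝ, d.τ₀ < τ₁ → O \ d.certifiedLate R τ₁ ⊆ 𝒟.metric.causalPast 𝒟.timeOrientation (d.certifiedSlab R τ₁)) ∧ (∀ i : Fin d.N, Summit.FinalStateConjecture.IsOrthochronous (d.motion i).1) ∧ (∀ (i : Fin d.N) (ρ : ℝ), ∀ᶠ τ in Filter.atTop, ∀ x ∈ (d.background i).truncTimeSlab ρ τ, ∀ w : E4, 𝒟.timeOrientation.IsFutureDirected (mfderiv 𝓘(ℝ, E4) (𝓡 4) (d.chart i) x w) → 0 < ((d.motion i).1 : E4 ≃L[ℝ] E4).symm w 0) ∧ (∀ᶠ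 τ in Filter.atTop, ∀ x ∈ (Minkowski.backgroundOn d.flatDomain).timeSlab τ, 𝒟.timeOrientation.IsFutureDirected (mfderiv 𝓘(ℝ, E4) (𝓡 4) d.flatChart x (E4.basisVector 0))) ∧ (∀ k : ℕ, Filter.Tendsto (fun τ => 𝒟.toSpacetime.deviationCk (Minkowski.backgroundOn d.flatDomain) d.flatChart k τ) Filter.atTop (nhds 0)) ∧ (∀ (i : Fin d.N) (k : ℕ) (ρ : ℝ) (ε : ENNReal), 0 < ε → ∀ᶠ τ in Filter.atTop, ∃ M a : ℝ, m₀ ≤ M ∧ M ≤ m₀⁻¹ ∧ |a| ≤ χ * M ∧ 𝒟.toSpacetime.truncDeviationCk ⟨(d.background i).domain, boostedKerrBilin (d.motion i).1 (d.motion i).2 M a, (d.background i).time, (d.background i).radius⟩ (d.chart i) k ρ τ ≤ ε ∧ 𝒟.toSpacetime.truncDeviationCk ⟨(d.background i).domain, boostedKerrBilin (d.motion i).1 (d.motion i).2 M a, (d.background i).time, (d.background i).radius⟩ (d.chart i) k (R i τ) τ ≤ ε))) 1 := by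
  intro hK X _ _ _ _ _ _ d hd
  obtain ⟨e, F, hF, hI, h0, hinj, hadm, hE⟩ := hK X d ⟨hd.1, fun h => hd.2 fun 𝒟 hmax =>
    ⟨(h 𝒟 hmax).1, stub_orientationGaugeAbsorption X d hd.1 𝒟 hmax (h 𝒟 hmax).1 (h 𝒟 hmax).2⟩⟩
  exact ⟨e, F, hF, hI, h0, hinj, hadm, fun c hc hmem => hE c hc ⟨hmem.1, fun h => hmem.2
    fun 𝒟 hmax => ⟨(h 𝒟 hmax).1,
      stub_orientationGaugeAbsorption X (F c) hmem.1 𝒟 hmax (h 𝒟 hmax).1 (h 𝒟 hmax).2⟩⟩⟩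

end Summit.FinalStateConjecture.FinalStateConjecture.Theorems.LogTimeThreeAnnuli.SubconvergentEraGeneric

end
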